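import Mathlib
import HarnessLib
import Summits.AtomisticToContinuum.Crystallization.Theorems.PricedLinkCensusSoftFourRingsTightPrep

/-!
# Soft four-rings: the tightness count

Support file for `SoftFourRings` (route `PricedLinkCensus`, sub-problem `Crystallization`).

Global setting: `X ⊂ S²` with `#X = 12`, pairwise `⟪·,·⟫ ≤ 1 − 1/(2·1.01²)`; a family `B` of 24 bond
pairs of close points, four at every vertex (the bond graph is 4-regular).  Notation (spelled out
in the statements): `nb(f)` = number of sides of the facet `f` outside `B`; a *bond triangle* is a
triangular facet with `nb = 0`; `t_v` = number of bond triangles at `v`; `V₃ = {v : t_v = 3}`;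
a *slack triangle* is a triangular facet with `nb = 2`.

`tight_counts_one_percent` (conditional on Tammes-13): **every vertex has `t_v ∈ {2, 3}`; every
non-bond triangular facet has `nb ∈ {1, 2}` and every quadrilateral facet has `nb = 0`; the
vertices of a slack triangle all lie in `V₃`; every `v ∈ V₃` lies in exactly one slack triangle;
and `3 T = 24 + #V₃`.**  Proof: the slack identity `T − 8 = Σ (nb − [triangle])`, the vertex bound
`t_v ≤ 3`, `Σ_v t_v = 3T`, and CLAIM B (every `v ∈ V₃` lies on a non-bond side of a slack facet),
squeezed against the per-facet bound `#{such v} ≤ 3 · slack`.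
-/

namespace Summit.AtomisticToContinuum.Crystallization.Theorems

open Real RealInnerProductSpace Literature.Geometry.DiscreteGeometry

section Setting

variable {X : Finset (EuclideanSpace ℝ (Fin 3))} {B : Finset (Finset (EuclideanSpace ℝ (Fin 3)))}
  (hT : musinTarasov2012_tammes_thirteen) (hX1 : ∀ y ∈ X, ‖y‖ = 1) (hcard : X.card = 12)
  (hsepX : ∀ u ∈ X, ∀ u' ∈ X, u ≠ u' → ⟪u, u'⟫ ≤ 1 - 1 / (2 * (101 / 100 : ℝ) ^ 2))
  (hB : ∀ T ∈ B, ∃ u ∈ X, ∃ u' ∈ X, u ≠ u' ∧ 1 - (101 / 100 : ℝ) ^ 2 / 2 ≤ ⟪u, u'⟫ ∧ T = {u, u'})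
  (hBcard : B.card = 24)
  (hdeg : ∀ v ∈ X, ∃ w : Fin 4 → EuclideanSpace ℝ (Fin 3), (∀ k, w k ∈ X) ∧
    Function.Injective w ∧ (∀ k, w k ≠ v) ∧
    (∀ k, ({v, w k} : Finset (EuclideanSpace ℝ (Fin 3))) ∈ B) ∧
    ∀ y, ({v, y} : Finset (EuclideanSpace ℝ (Fin 3))) ∈ B → ∃ k, y = w k)

include hT hX1 hcard hsepX hB hBcard hdeg in
open scoped Classical in
/-- **The tightness count** (conditional on Tammes-13); see the module docstring.  With
`nb(f) = #{sides of f outside B}`, bond triangles (`#f = 3`, `nb = 0`), `t_v`, `V₃ = {t_v = 3}`: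
`3T = 24 + #V₃`; `t_v ∈ {2, 3}`; non-bond triangles have `nb ≤ 2`, quadrilaterals `nb = 0`; the
vertices of a triangle with `nb = 2` lie in `V₃`; each `v ∈ V₃` lies in exactly one such triangle. -/
theorem tight_counts_one_percent :
    (3 * ((facetNormals X).filter (fun c => (tightSet X c).card = 3 ∧
        ((edgesOfFacet X c).filter (fun T => T ∉ B)).card = 0)).card
      = 24 + (X.filter (fun v => ((facetNormals X).filter (fun c => v ∈ tightSet X c ∧
          (tightSet X c).card = 3 ∧ ((edgesOfFacet X c).filter (fun T => T ∉ B)).card = 0)).card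
            = 3)).card) ∧
    (∀ v ∈ X, ((facetNormals X).filter (fun c => v ∈ tightSet X c ∧
          (tightSet X c).card = 3 ∧ ((edgesOfFacet X c).filter (fun T => T ∉ B)).card = 0)).card = 2 ∨
        ((facetNormals X).filter (fun c => v ∈ tightSet X c ∧
          (tightSet X c).card = 3 ∧ ((edgesOfFacet X c).filter (fun T => T ∉ B)).card = 0)).card = 3) ∧
    (∀ c ∈ facetNormals X,
        ((tightSet X c).card = 3 → ((edgesOfFacet X c).filter (fun T => T ∉ B)).card ≤ 2) ∧
        ((tightSet X c).card = 4 → ((edgesOfFacet X c).filter (fun T => T ∉ B)).card = 0)) ∧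
    (∀ c ∈ facetNormals X, (tightSet X c).card = 3 →
        ((edgesOfFacet X c).filter (fun T => T ∉ B)).card = 2 → ∀ u ∈ tightSet X c,
          ((facetNormals X).filter (fun c => u ∈ tightSet X c ∧
            (tightSet X c).card = 3 ∧ ((edgesOfFacet X c).filter (fun T => T ∉ B)).card = 0)).card
              = 3) ∧
    (∀ u ∈ X, ((facetNormals X).filter (fun c => u ∈ tightSet X c ∧
          (tightSet X c).card = 3 ∧ ((edgesOfFacet X c).filter (fun T => T ∉ B)).card = 0)).card = 3 →
        ∃ c ∈ facetNormals X, (tightSet X c).card = 3 ∧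
          ((edgesOfFacet X c).filter (fun T => T ∉ B)).card = 2 ∧ u ∈ tightSet X c ∧
          ∀ c' ∈ facetNormals X, (tightSet X c').card = 3 →
            ((edgesOfFacet X c').filter (fun T => T ∉ B)).card = 2 → u ∈ tightSet X c' → c' = c) := by
  -- abbreviations
  set F := facetNormals X with hF
  set nb : EuclideanSpace ℝ (Fin 3) → ℕ :=
    fun c => ((edgesOfFacet X c).filter (fun T => T ∉ B)).card with hnb
  set bt : EuclideanSpace ℝ (Fin 3) → Prop := fun c => (tightSet X c).card = 3 ∧ nb c = 0 with hbt
  set tv : EuclideanSpace ℝ (Fin 3) → ℕ :=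
    fun v => (F.filter (fun c => v ∈ tightSet X c ∧ bt c)).card with htv
  set T := (F.filter bt).card with hTdef
  set sl : EuclideanSpace ℝ (Fin 3) → ℕ :=
    fun c => nb c - (if (tightSet X c).card = 3 then 1 else 0) with hsl
  set SLp : EuclideanSpace ℝ (Fin 3) → Prop :=
    fun c => ((tightSet X c).card = 3 ∧ 2 ≤ nb c) ∨ ((tightSet X c).card ≠ 3 ∧ 1 ≤ nb c) with hSLp
  set V3 := X.filter (fun v => tv v = 3) with hV3
  set DV : EuclideanSpace ℝ (Fin 3) → Finset (EuclideanSpace ℝ (Fin 3)) :=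
    fun c => (tightSet X c).filter (fun v => v ∈ V3 ∧ ∃ T ∈ edgesOfFacet X c, T ∉ B ∧ v ∈ T)
    with hDV
  -- global facts
  have h0 : (0 : EuclideanSpace ℝ (Fin 3)) ∈ interior (convexHull ℝ (X : Set (EuclideanSpace ℝ (Fin 3)))) :=
    zero_mem_interior_convexHull_of_twelve_le_card hT hX1 hcard.ge
      (ca := 1 - 1 / (2 * (101 / 100 : ℝ) ^ 2)) (by norm_num) hsepX
  obtain ⟨-, hBH, -, -, -, h34, -, hF3⟩ := hull_counts_of_twelve hT hX1 hcard hsepX hB hBcard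
  have hsides : ∀ c, ∀ T' ∈ edgesOfFacet X c, T'.card = 2 ∧ T' ⊆ tightSet X c := by
    intro c T' hT'
    unfold edgesOfFacet at hT'
    obtain ⟨hH, hsub⟩ := Finset.mem_filter.1 hT'
    exact ⟨card_eq_two_of_mem_hullEdges hH, hsub⟩
  have hnb_le : ∀ c ∈ F, nb c ≤ (tightSet X c).card := by
    intro c hc
    calc nb c ≤ (edgesOfFacet X c).card := Finset.card_filter_le _ _
      _ = (tightSet X c).card := card_edgesOfFacet hX1 h0 hc
  -- (1) the slack identity in `ℕ`: `T = 8 + s`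
  have hsl_le : ∀ c ∈ F, ¬ bt c → (if (tightSet X c).card = 3 then 1 else 0) ≤ nb c := by
    intro c _ hnbt
    split_ifs with h3
    · by_contra h
      exact hnbt ⟨h3, by omega⟩
    · exact Nat.zero_le _
  have hslackZ := bondTriangles_slack_identity hX1 h0 hBH hBcard hF3
  have hcast : ∑ c ∈ F.filter (fun c => ¬ bt c), (((nb c : ℕ) : ℤ) - if (tightSet X c).card = 3 then 1 else 0)
      = ((∑ c ∈ F.filter (fun c => ¬ bt c), sl c : ℕ) : ℤ) := by
    push_cast
    refine Finset.sum_congr rfl fun c hc => ?_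
    obtain ⟨hcF, hnbt⟩ := Finset.mem_filter.1 hc
    rw [hsl]
    simp only
    rw [Nat.cast_sub (hsl_le c hcF hnbt)]
    push_cast
    split_ifs <;> simp
  set s := ∑ c ∈ F.filter (fun c => ¬ bt c), sl c with hs
  have hTs : T = 8 + s := by
    have : ((T : ℕ) : ℤ) - 8 = (s : ℤ) := by rw [← hcast]; exact hslackZ
    omega
  -- (2) `Σ_{SL} sl = s`
  have hSL_nbt : ∀ c, SLp c → ¬ bt c := by
    rintro c (⟨h3, h2⟩ | ⟨hne, h1⟩) ⟨h3', h0'⟩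
    · omega
    · exact hne h3'
  have hsumSL : ∑ c ∈ F.filter SLp, sl c = s := by
    rw [hs, ← Finset.sum_filter_add_sum_filter_not (F.filter (fun c => ¬ bt c)) SLp]
    have h1 : (F.filter (fun c => ¬ bt c)).filter SLp = F.filter SLp := by
      ext c; simp only [Finset.mem_filter]
      constructor
      · rintro ⟨⟨hc, -⟩, h⟩; exact ⟨hc, h⟩
      · rintro ⟨hc, h⟩; exact ⟨⟨hc, hSL_nbt c h⟩, h⟩
    have h2 : ∑ c ∈ (F.filter (fun c => ¬ bt c)).filter (fun c => ¬ SLp c), sl c = 0 := by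
      refine Finset.sum_eq_zero fun c hc => ?_
      obtain ⟨hc', hnsl⟩ := Finset.mem_filter.1 hc
      obtain ⟨hcF, hnbt⟩ := Finset.mem_filter.1 hc'
      rw [hsl]; simp only
      rw [hSLp] at hnsl
      simp only [not_or, not_and, not_le] at hnsl
      split_ifs with h3
      · have := hnsl.1 h3; omega
      · have := hnsl.2 h3; omega
    rw [h1, h2, add_zero]
  -- (3) `Φ ≤ 3 s`
  have hΦle : ∑ c ∈ F.filter SLp, (DV c).card ≤ 3 * s := by
    rw [← hsumSL, Finset.mul_sum]
    refine Finset.sum_le_sum fun c hc => ?_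
    obtain ⟨hcF, hslc⟩ := Finset.mem_filter.1 hc
    exact card_filter_on_nonbond_side_le (B := B) (fun v => v ∈ V3) (fun T' hT' => (hsides c T' hT').1)
      (h34 c hcF) hslc
  -- (4) `#V₃ ≤ Φ`
  have hDVsub : ∀ c, V3.filter (fun v => v ∈ DV c) = DV c := by
    intro c; ext v
    simp only [Finset.mem_filter, hDV]
    tauto
  have hdc : ∑ v ∈ V3, ((F.filter SLp).filter (fun c => v ∈ DV c)).card
      = ∑ c ∈ F.filter SLp, (DV c).card := by
    calc _ = ∑ c ∈ F.filter SLp, (V3.filter (fun v => v ∈ DV c)).card :=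
          Finset.sum_card_bipartiteAbove_eq_sum_card_bipartiteBelow _
      _ = ∑ c ∈ F.filter SLp, (DV c).card := Finset.sum_congr rfl fun c _ => by rw [hDVsub]
  have hge1 : ∀ v ∈ V3, 1 ≤ ((F.filter SLp).filter (fun c => v ∈ DV c)).card := fun v hv => by
    obtain ⟨hvX, htv3⟩ := Finset.mem_filter.1 hv
    obtain ⟨c, hcF, hvc, hside, hslc⟩ :=
      exists_slackFacet_of_three hT hX1 hcard hsepX hB hdeg hvX htv3
    refine Finset.card_pos.2 ⟨c, Finset.mem_filter.2 ⟨Finset.mem_filter.2 ⟨hcF, hslc⟩, ?_⟩⟩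
    exact Finset.mem_filter.2 ⟨hvc, hv, hside⟩
  have hΦge : V3.card ≤ ∑ c ∈ F.filter SLp, (DV c).card := by
    calc V3.card = ∑ v ∈ V3, 1 := by simp
      _ ≤ ∑ v ∈ V3, ((F.filter SLp).filter (fun c => v ∈ DV c)).card := Finset.sum_le_sum hge1
      _ = ∑ c ∈ F.filter SLp, (DV c).card := hdc
  -- (5) `t_v ≤ 3` and `Σ t_v = 3T`
  have htv_le : ∀ v ∈ X, tv v ≤ 3 := by
    intro v hv
    obtain ⟨w, hwX, hwinj, hwv, hvw, hvonly⟩ := hdeg v hv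
    exact card_bondTriangles_at_le_three hX1 h0 hsepX hB hv w hwX hwinj hwv hvw hvonly
  have htv_sum : ∑ v ∈ X, tv v = 3 * T := by
    have := sum_card_triangles_containing X (F.filter bt) (fun c hc => (Finset.mem_filter.1 hc).2.1)
    rw [← this]
    refine Finset.sum_congr rfl fun v _ => ?_
    rw [htv]; simp only
    rw [Finset.filter_filter]
    congr 1
    exact Finset.filter_congr fun c _ => by tauto
  -- (6) arithmetic
  have hsum3 : ∑ v ∈ X, (3 - tv v) + 3 * T = 36 := by
    rw [← htv_sum, ← Finset.sum_add_distrib]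
    rw [Finset.sum_congr rfl fun v hv => Nat.sub_add_cancel (htv_le v hv), Finset.sum_const, hcard]
    rfl
  have hcount : (X.filter (fun v => tv v ≠ 3)).card ≤ ∑ v ∈ X, (3 - tv v) := by
    rw [Finset.card_filter]
    refine Finset.sum_le_sum fun v hv => ?_
    have := htv_le v hv
    split_ifs with h <;> omega
  have hsplit : V3.card + (X.filter (fun v => tv v ≠ 3)).card = 12 := by
    rw [hV3, Finset.card_filter_add_card_filter_not, hcard]
  have hn3 : V3.card = 3 * s := by omega
  have hΦeq : ∑ c ∈ F.filter SLp, (DV c).card = 3 * s := by omega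
  have hcount_eq : ∑ v ∈ X, (3 - tv v) = (X.filter (fun v => tv v ≠ 3)).card := by omega
  -- C1: every `t_v ∈ {2, 3}`
  have hC1 : ∀ v ∈ X, tv v = 2 ∨ tv v = 3 := by
    rw [Finset.card_filter] at hcount_eq
    have hterm := (Finset.sum_eq_sum_iff_of_le (fun v hv => show (if tv v ≠ 3 then 1 else 0) ≤ 3 - tv v by
      have := htv_le v hv; split_ifs with h <;> omega)).1 hcount_eq.symm
    intro v hv
    have h := hterm v hv
    have := htv_le v hv
    split_ifs at h with h3 <;> omega
  -- termwise equality in (3)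
  have hterm3 : ∀ c ∈ F.filter SLp, (DV c).card = 3 * sl c := by
    have hle : ∀ c ∈ F.filter SLp, (DV c).card ≤ 3 * sl c := fun c hc => by
      obtain ⟨hcF, hslc⟩ := Finset.mem_filter.1 hc
      exact card_filter_on_nonbond_side_le (B := B) (fun v => v ∈ V3) (fun T' hT' => (hsides c T' hT').1)
        (h34 c hcF) hslc
    have heq : ∑ c ∈ F.filter SLp, (DV c).card = ∑ c ∈ F.filter SLp, 3 * sl c := by
      rw [hΦeq, ← hsumSL, Finset.mul_sum]
    exact (Finset.sum_eq_sum_iff_of_le hle).1 heq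
  -- C2
  have hC2 : ∀ c ∈ F, ((tightSet X c).card = 3 → nb c ≤ 2) ∧ ((tightSet X c).card = 4 → nb c = 0) := by
    intro c hcF
    have hDVle : (DV c).card ≤ (tightSet X c).card := Finset.card_filter_le _ _
    constructor
    · intro h3
      by_contra h
      have hSL : SLp c := Or.inl ⟨h3, by omega⟩
      have := hterm3 c (Finset.mem_filter.2 ⟨hcF, hSL⟩)
      rw [hsl] at this; simp only [h3, if_true] at this
      omega
    · intro h4
      by_contra h
      have hSL : SLp c := Or.inr ⟨by omega, by omega⟩
      have heq := hterm3 c (Finset.mem_filter.2 ⟨hcF, hSL⟩)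
      rw [hsl] at heq; simp only [show (tightSet X c).card ≠ 3 by omega, if_false] at heq
      rcases Nat.lt_or_ge 1 (nb c) with hlt | hge
      · omega
      · have h1 : nb c = 1 := by omega
        have := card_filter_on_nonbond_side_le_two (B := B) (fun v => v ∈ V3)
          (fun T' hT' => (hsides c T' hT').1) h1
        change (DV c).card ≤ 2 at this
        omega
  -- C3
  have hC3 : ∀ c ∈ F, (tightSet X c).card = 3 → nb c = 2 → ∀ u ∈ tightSet X c, tv u = 3 := by
    intro c hcF h3 h2 u hu
    have hSL : SLp c := Or.inl ⟨h3, by omega⟩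
    have heq := hterm3 c (Finset.mem_filter.2 ⟨hcF, hSL⟩)
    rw [hsl] at heq; simp only [h3, if_true, h2] at heq
    have hfull : DV c = tightSet X c := Finset.eq_of_subset_of_card_le (Finset.filter_subset _ _) (by omega)
    have : u ∈ DV c := by rw [hfull]; exact hu
    exact (Finset.mem_filter.1 (Finset.mem_filter.1 this).2.1).2
  -- termwise equality in (4): each `v ∈ V₃` is in exactly one slack facet
  have hterm4 : ∀ v ∈ V3, ((F.filter SLp).filter (fun c => v ∈ DV c)).card = 1 := by
    have heq : ∑ v ∈ V3, (1 : ℕ) = ∑ v ∈ V3, ((F.filter SLp).filter (fun c => v ∈ DV c)).card := by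
      rw [hdc, hΦeq, ← hn3]
      simp
    intro v hv
    exact ((Finset.sum_eq_sum_iff_of_le hge1).1 heq v hv).symm
  -- C5
  have hC5 : ∀ u ∈ X, tv u = 3 → ∃ c ∈ F, (tightSet X c).card = 3 ∧ nb c = 2 ∧ u ∈ tightSet X c ∧
      ∀ c' ∈ F, (tightSet X c').card = 3 → nb c' = 2 → u ∈ tightSet X c' → c' = c := by
    intro u hu htu
    have huV : u ∈ V3 := Finset.mem_filter.2 ⟨hu, htu⟩
    obtain ⟨c₀, hc₀⟩ := Finset.card_eq_one.1 (hterm4 u huV)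
    have hmem : c₀ ∈ (F.filter SLp).filter (fun c => u ∈ DV c) := by
      rw [hc₀]; exact Finset.mem_singleton_self _
    obtain ⟨hc₀', huDV⟩ := Finset.mem_filter.1 hmem
    obtain ⟨hc₀F, hSL₀⟩ := Finset.mem_filter.1 hc₀'
    have h3 : (tightSet X c₀).card = 3 := by
      rcases h34 c₀ hc₀F with h | h
      · exact h
      · exfalso
        have h0' : nb c₀ = 0 := (hC2 c₀ hc₀F).2 h
        rcases hSL₀ with ⟨h3, _⟩ | ⟨_, h1⟩
        · omega
        · change 1 ≤ nb c₀ at h1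
          omega
    have h2 : nb c₀ = 2 := by
      have := (hC2 c₀ hc₀F).1 h3
      rcases hSL₀ with ⟨_, h2⟩ | ⟨hne, _⟩
      · omega
      · exact absurd h3 hne
    refine ⟨c₀, hc₀F, h3, h2, (Finset.mem_filter.1 huDV).1, ?_⟩
    intro c' hc'F h3' h2' huc'
    have hSL' : SLp c' := Or.inl ⟨h3', by omega⟩
    have huDV' : u ∈ DV c' := by
      refine Finset.mem_filter.2 ⟨huc', huV, ?_⟩
      exact exists_nonbond_side_of_two (B := B) (hsides c') h3' (by change 2 ≤ nb c'; omega) huc'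
    have : c' ∈ (F.filter SLp).filter (fun c => u ∈ DV c) :=
      Finset.mem_filter.2 ⟨Finset.mem_filter.2 ⟨hc'F, hSL'⟩, huDV'⟩
    rw [hc₀, Finset.mem_singleton] at this
    exact this
  have hC6 : 3 * T = 24 + V3.card := by omega
  exact ⟨hC6, hC1, hC2, hC3, hC5⟩

end Setting


end Summit.AtomisticToContinuum.Crystallization.Theorems
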